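import Summits.HodgeConjecture.CorCM.PairFlipSexticReflexSlotBalls
import Summits.HodgeConjecture.CorCM.SexticCMFieldPairFlip
import Summits.HodgeConjecture.CorCM.CyclicCMSurfaceTimesCMHodge
import Literature.AlgebraicGeometry.Motives.HodgeStructureOfCMType
import HarnessLib

/-!
# A CM threefold with pair-flip sextic field against a CM fourfold with CM by the REFLEX field: the pair is decided
# by the types — collapse on one isogeny class of nondegenerate fourfolds, additivity everywhere else

COR-CM (cell `pub-hodgecm2`, binder seat `b16` gen 45, count-neutral claim REFLEX-OCTIC-34, file F5); NEW as stated,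
hence under `Summits/`.  Theorems only; no definition, no named fact, no `sorry`.

Setting: `K_{i₀}` a SEXTIC CM field with PAIR FLIPS (every conjugate pair of complex embeddings is exchanged by an
automorphism of `ℂ` fixing the other four — equivalently its Galois closure has degree `24` or `48`,
`SexticCMFieldPairFlip`), with a CM type `Φ_T = Φ_{i₀}` (all of them nondegenerate; realisations: SIMPLE CM abelian
threefolds `T`), and `K_{i₁}` a CM field with an embedding `ψ₀ : K_{i₁} → ℂ` whose fixer in `Aut(ℂ)` is the
stabiliser of `Φ_T` — i.e. `ψ₀(K_{i₁})` IS THE REFLEX FIELD `K*` of `(K_{i₀}, Φ_T)` (Shimura §8.3 Prop. 28); then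
`[K_{i₁} : ℚ] = 8` (`finrank_eq_eight_of_reflexOctic`, Dodson's Reflex Degree Theorem) and
`Hom(K_{i₁}, ℂ) = {σψ₀}` is identified with the eight CM types `σΦ_T` of `K_{i₀}` (a cube; complex conjugation = the
antipode; the FLIP-NEIGHBOURS `σ_xψ₀`, `σ_x` a pair flip at `x ∈ Φ_T`, are the three embeddings whose attached type
differs from `Φ_T` in one place).  Let `Ψ = Φ_{i₁}` be any CM type of `K_{i₁}` (realisations: CM abelian FOURFOLDS `F`).
Say `Ψ` is THE HAMMING BALL AROUND `Φ_T` if `ψ₀ ∈ Ψ` and `σψ₀ ∈ Ψ` for every pair flip `σ` at a point of `Φ_T`, and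
THE HAMMING BALL AROUND `Φ̄_T` if none of these four embeddings lies in `Ψ`.

> **Theorem** (`isNondegenerateFamily_iff_of_reflexOctic`).  `(Φ_T, Ψ)` is a nondegenerate family iff `Ψ` is
> nondegenerate and `Ψ` is neither of the two Hamming balls.  More precisely: on the two Hamming balls the rank
> COLLAPSES, `rank(Φ_T, Ψ) = rank(Ψ)` (`cmFamilyRank_eq_of_reflexOctic_ball`: `Hg(T × F) → Hg(F)` is an isogeny,
> defect `3`); off them it is ADDITIVE, `rank(Φ_T, Ψ) = rank(Ψ) + 3` (`cmFamilyRank_eq_add_three_of_reflexOctic`: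
> `Hg(T × F) = Hg(T) × Hg(F)`).

Consequences (§3): off the balls and for nondegenerate `Ψ`, the Hodge conjecture and `B• = D•` hold on EVERY
`T^a × F^b` (`hodgeConjectureFor_prod_of_reflexOctic`); on the balls some `T^a × F^b` carries an exceptional Hodge class
although `T`, `F` are simple, `F` may be NONDEGENERATE, and `K_{i₀}`, `K_{i₁}` share no imaginary quadratic subfield
(`exists_exceptional_prod_of_reflexOctic_ball`) — an exotic pair in dimension `7`, exactly one isogeny class of `F` for
each `T` (the two balls are complex conjugate types).  The REFLEX TYPE of `Φ_T` (a face of the cube; degenerate by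
Dodson 1984 §3.3.2) is off the balls: `T × T^{reflex}` is additive.  Everything is the number-field dress of the
abstract `PairFlipSexticReflexSlotRank` / `PairFlipSexticReflexSlotBalls` (reflex slot `T : Hom(K_{i₁}, ℂ) → {types of K_{i₀}}` from
`ReflexSlotIncidence.exists_typeMap`).

## References

* [Dodson1984] B. Dodson, *The structure of Galois groups of CM-fields*, Trans. AMS 283 (1984), §1 (Reflex Degree
  Theorem), §3.3.2 (Theorem), Prop. 5.2.2, §5.1.2.
* [Shimura1998] G. Shimura, *Abelian Varieties with Complex Multiplication and Modular Functions*, §8.3 Prop. 28, §8.4.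
* [Gordon1999HodgeAVSurvey] B. B. Gordon, *A survey of the Hodge conjecture for abelian varieties*, §3, 7.5–7.7, 10.10.
* [MoonenZarhin1999LowDim] B. Moonen, Yu. Zarhin, *Hodge classes on abelian varieties of low dimension*, Math. Ann. 315
  (1999).
-/

noncomputable section

open CategoryTheory CategoryTheory.Limits NumberField Module
open scoped BigOperators Classical

namespace Summit.HodgeConjecture.CorCM

open Literature.NumberTheory.ComplexMultiplication
open Literature.AlgebraicGeometry.Motives (AbelianVariety CMType)
open Literature.AlgebraicGeometry.HodgeTheory
open Literature.AlgebraicGeometry.ComplexMultiplication (IsCMTypeRealisation isSimple_iff_isPrimitive)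
open Literature.AlgebraicGeometry.VanGeemen1994 (hodgeClassSpan)
open Literature.AlgebraicGeometry.Pohlmann1968
open Literature.Barriers.HodgeConjecture (divisorClassesSpan)

section Types

variable {I : Type} {K : I → Type} [∀ i, Field (K i)] [∀ i, NumberField (K i)] [∀ i, IsCMField (K i)] [Fintype I]

omit [∀ i, IsCMField (K i)] in
/-- `|⊔_i Hom(K_i, ℂ)| = Σ_i [K_i : ℚ]`. [folklore] -/
private theorem card_sigma_ringHom_eq_sum₄₅ :
    Fintype.card ((i : I) × (K i →+* ℂ)) = ∑ i, finrank ℚ (K i) := by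
  rw [Fintype.card_sigma]
  exact Finset.sum_congr rfl fun i _ => Embeddings.card (K i) ℂ

/-! ### §1 The reflex slot of a pair-flip sextic type -/

omit [∀ i, IsCMField (K i)] [Fintype I] in
/-- **The reflex-slot data.**  For a sextic CM field with pair flips, a type `Φ_T = {x₁, x₂, x₃}` and an embedding
`ψ₀` of a second CM field with `Fix(ψ₀) = Stab(Φ_T)` in `Aut(ℂ)`: the type map `T` of `ReflexSlotIncidence`, the three
points and their three flips. [cite: Shimura1998, §8.3 Prop. 28] [cite: Dodson1984, §1 (Reflex Degree Theorem)] -/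
theorem exists_reflexSlot_data {i₀ i₁ : I} (h6 : finrank ℚ (K i₀) = 6)
    (hflip : ∀ s : K i₀ →+* ℂ, ∃ σ : ℂ ≃+* ℂ, σ • s = (starRingAut : ℂ ≃+* ℂ) • s ∧
      ∀ t : K i₀ →+* ℂ, t ≠ s → t ≠ (starRingAut : ℂ ≃+* ℂ) • s → σ • t = t)
    (Φ : ∀ i, CMType (K i)) {ψ₀ : K i₁ →+* ℂ}
    (hψ₀ : ∀ σ : ℂ ≃+* ℂ, σ • ψ₀ = ψ₀ ↔ ∀ x : K i₀ →+* ℂ, σ • x ∈ (Φ i₀).1 ↔ x ∈ (Φ i₀).1) :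
    ∃ (T : (K i₁ →+* ℂ) → Set (K i₀ →+* ℂ)) (x₁ x₂ x₃ : K i₀ →+* ℂ) (φ₁ φ₂ φ₃ : ℂ ≃+* ℂ),
      (∀ (g : ℂ ≃+* ℂ) (y : K i₁ →+* ℂ) (x : K i₀ →+* ℂ), x ∈ T (g • y) ↔ g⁻¹ • x ∈ T y) ∧
      Function.Injective T ∧ T ψ₀ = (Φ i₀).1 ∧ (∀ y : K i₁ →+* ℂ, ∃ g : ℂ ≃+* ℂ, g • ψ₀ = y) ∧
      (Φ i₀).1 = {x₁, x₂, x₃} ∧ x₁ ≠ x₂ ∧ x₁ ≠ x₃ ∧ x₂ ≠ x₃ ∧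
      (φ₁ • x₁ = (starRingAut : ℂ ≃+* ℂ) • x₁ ∧
        ∀ z : K i₀ →+* ℂ, z ≠ x₁ → z ≠ (starRingAut : ℂ ≃+* ℂ) • x₁ → φ₁ • z = z) ∧
      (φ₂ • x₂ = (starRingAut : ℂ ≃+* ℂ) • x₂ ∧
        ∀ z : K i₀ →+* ℂ, z ≠ x₂ → z ≠ (starRingAut : ℂ ≃+* ℂ) • x₂ → φ₂ • z = z) ∧
      (φ₃ • x₃ = (starRingAut : ℂ ≃+* ℂ) • x₃ ∧
        ∀ z : K i₀ →+* ℂ, z ≠ x₃ → z ≠ (starRingAut : ℂ ≃+* ℂ) • x₃ → φ₃ • z = z) := by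
  haveI := isPretransitive_ringEquiv_complex (K := K i₁)
  have hY : ∀ y : K i₁ →+* ℂ, ∃ g : ℂ ≃+* ℂ, g • ψ₀ = y := fun y => MulAction.exists_smul_eq (ℂ ≃+* ℂ) ψ₀ y
  obtain ⟨T, hT, hTi, hT₀⟩ := ReflexSlot.exists_typeMap (G := ℂ ≃+* ℂ) (Φ₀ := (Φ i₀).1) (y₀ := ψ₀) hψ₀ hY
  have h3 : (Φ i₀).1.ncard = 3 := by
    have := Literature.AlgebraicGeometry.Motives.HodgeStructure.two_mul_ncard_cmType_eq_finrank (Φ i₀); omega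
  obtain ⟨x₁, x₂, x₃, h12, h13, h23, hx⟩ := Set.ncard_eq_three.1 h3
  obtain ⟨φ₁, hφ₁⟩ := hflip x₁
  obtain ⟨φ₂, hφ₂⟩ := hflip x₂
  obtain ⟨φ₃, hφ₃⟩ := hflip x₃
  exact ⟨T, x₁, x₂, x₃, φ₁, φ₂, φ₃, hT, hTi, hT₀, hY, hx, h12, h13, h23, hφ₁, hφ₂, hφ₃⟩

omit [Fintype I] in
/-- **The reflex field of a CM type on a sextic CM field with pair flips is OCTIC**: `[K_{i₁} : ℚ] = 8`.
Dodson's Reflex Degree Theorem `[K' : ℚ] = 2^v (G₀ : S₀)` with `v = 3`, `S₀ = G₀`.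
[cite: Dodson1984, §1 (Reflex Degree Theorem)] -/
theorem finrank_eq_eight_of_reflexOctic {i₀ i₁ : I} (h6 : finrank ℚ (K i₀) = 6)
    (hflip : ∀ s : K i₀ →+* ℂ, ∃ σ : ℂ ≃+* ℂ, σ • s = (starRingAut : ℂ ≃+* ℂ) • s ∧
      ∀ t : K i₀ →+* ℂ, t ≠ s → t ≠ (starRingAut : ℂ ≃+* ℂ) • s → σ • t = t)
    (Φ : ∀ i, CMType (K i)) {ψ₀ : K i₁ →+* ℂ}
    (hψ₀ : ∀ σ : ℂ ≃+* ℂ, σ • ψ₀ = ψ₀ ↔ ∀ x : K i₀ →+* ℂ, σ • x ∈ (Φ i₀).1 ↔ x ∈ (Φ i₀).1) :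
    finrank ℚ (K i₁) = 8 := by
  obtain ⟨T, x₁, x₂, x₃, φ₁, φ₂, φ₃, hT, hTi, hT₀, hY, hx, h12, h13, h23, -, hφ₂, hφ₃⟩ :=
    exists_reflexSlot_data h6 hflip Φ hψ₀
  rw [← Embeddings.card (K i₁) ℂ]
  exact ReflexSlot.card_eq_eight (isCMTypeWith_conj (Φ i₀)) hT hTi hT₀ hY hx h12 h13 h23 hφ₂ hφ₃

/-! ### §2 The rank: collapse on the Hamming balls, additivity off them -/

/-- **COLLAPSE on the Hamming balls.**  If `Ψ = Φ_{i₁}` contains `ψ₀` and its three flip-neighbours (or none of the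
four), then `rank(Φ_T, Ψ) = rank(Ψ)`: `Hg(T × F) → Hg(F)` is an isogeny. [cite: Gordon1999HodgeAVSurvey, 7.5–7.7]
[cite: Dodson1984, §3.3.2 and Prop. 5.2.2] -/
theorem cmFamilyRank_eq_of_reflexOctic_ball {i₀ i₁ : I} (hI : ∀ j, j = i₀ ∨ j = i₁)
    (h6 : finrank ℚ (K i₀) = 6)
    (hflip : ∀ s : K i₀ →+* ℂ, ∃ σ : ℂ ≃+* ℂ, σ • s = (starRingAut : ℂ ≃+* ℂ) • s ∧
      ∀ t : K i₀ →+* ℂ, t ≠ s → t ≠ (starRingAut : ℂ ≃+* ℂ) • s → σ • t = t)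
    (Φ : ∀ i, CMType (K i)) {ψ₀ : K i₁ →+* ℂ}
    (hψ₀ : ∀ σ : ℂ ≃+* ℂ, σ • ψ₀ = ψ₀ ↔ ∀ x : K i₀ →+* ℂ, σ • x ∈ (Φ i₀).1 ↔ x ∈ (Φ i₀).1)
    (hball : (ψ₀ ∈ (Φ i₁).1 ∧ ∀ (x : K i₀ →+* ℂ) (σ : ℂ ≃+* ℂ), x ∈ (Φ i₀).1 →
        σ • x = (starRingAut : ℂ ≃+* ℂ) • x →
        (∀ t : K i₀ →+* ℂ, t ≠ x → t ≠ (starRingAut : ℂ ≃+* ℂ) • x → σ • t = t) → σ • ψ₀ ∈ (Φ i₁).1) ∨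
      (ψ₀ ∉ (Φ i₁).1 ∧ ∀ (x : K i₀ →+* ℂ) (σ : ℂ ≃+* ℂ), x ∈ (Φ i₀).1 →
        σ • x = (starRingAut : ℂ ≃+* ℂ) • x →
        (∀ t : K i₀ →+* ℂ, t ≠ x → t ≠ (starRingAut : ℂ ≃+* ℂ) • x → σ • t = t) → σ • ψ₀ ∉ (Φ i₁).1)) :
    CMAlgebra.cmFamilyRank Φ = cmTypeRank (Φ i₁) := by
  obtain ⟨T, x₁, x₂, x₃, φ₁, φ₂, φ₃, hT, hTi, hT₀, hY, hx, h12, h13, h23, hφ₁, hφ₂, hφ₃⟩ :=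
    exists_reflexSlot_data h6 hflip Φ hψ₀
  obtain ⟨m₁, m₂, m₃⟩ := ReflexSlot.mem_of_eq_triple hx
  have h := fun i => isCMTypeWith_conj (Φ i)
  have hb := (ReflexSlot.faceSums_eq_iff_ball (Φ := fun i => (Φ i).1) h hT hTi hT₀ hY hx h12 h13 h23 hφ₁ hφ₂
    hφ₃).2 (by
      rcases hball with ⟨h0, hall⟩ | ⟨h0, hall⟩
      · exact Or.inl ⟨h0, hall x₁ φ₁ m₁ hφ₁.1 hφ₁.2, hall x₂ φ₂ m₂ hφ₂.1 hφ₂.2, hall x₃ φ₃ m₃ hφ₃.1 hφ₃.2⟩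
      · exact Or.inr ⟨h0, hall x₁ φ₁ m₁ hφ₁.1 hφ₁.2, hall x₂ φ₂ m₂ hφ₂.1 hφ₂.2, hall x₃ φ₃ m₃ hφ₃.1 hφ₃.2⟩)
  obtain ⟨e12, e23, hne⟩ := hb
  exact ReflexSlot.typeRank_sigmaType_eq_of_faceSums_eq (Φ := fun i => (Φ i).1) h hI hT hT₀ hY hx hne rfl e12.symm
    (e23.symm.trans e12.symm)

/-- **On the Hamming balls the pair is DEGENERATE** (defect `3`: `rank(Φ_T, Ψ) = rank(Ψ) ≤ 5 < 8`).
[cite: Gordon1999HodgeAVSurvey, 7.5–7.7] [cite: Dodson1984, §3.3.2] -/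
theorem not_isNondegenerateFamily_of_reflexOctic_ball {i₀ i₁ : I} (h01 : i₀ ≠ i₁) (hI : ∀ j, j = i₀ ∨ j = i₁)
    (h6 : finrank ℚ (K i₀) = 6)
    (hflip : ∀ s : K i₀ →+* ℂ, ∃ σ : ℂ ≃+* ℂ, σ • s = (starRingAut : ℂ ≃+* ℂ) • s ∧
      ∀ t : K i₀ →+* ℂ, t ≠ s → t ≠ (starRingAut : ℂ ≃+* ℂ) • s → σ • t = t)
    (Φ : ∀ i, CMType (K i)) {ψ₀ : K i₁ →+* ℂ}
    (hψ₀ : ∀ σ : ℂ ≃+* ℂ, σ • ψ₀ = ψ₀ ↔ ∀ x : K i₀ →+* ℂ, σ • x ∈ (Φ i₀).1 ↔ x ∈ (Φ i₀).1)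
    (hball : (ψ₀ ∈ (Φ i₁).1 ∧ ∀ (x : K i₀ →+* ℂ) (σ : ℂ ≃+* ℂ), x ∈ (Φ i₀).1 →
        σ • x = (starRingAut : ℂ ≃+* ℂ) • x →
        (∀ t : K i₀ →+* ℂ, t ≠ x → t ≠ (starRingAut : ℂ ≃+* ℂ) • x → σ • t = t) → σ • ψ₀ ∈ (Φ i₁).1) ∨
      (ψ₀ ∉ (Φ i₁).1 ∧ ∀ (x : K i₀ →+* ℂ) (σ : ℂ ≃+* ℂ), x ∈ (Φ i₀).1 →
        σ • x = (starRingAut : ℂ ≃+* ℂ) • x →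
        (∀ t : K i₀ →+* ℂ, t ≠ x → t ≠ (starRingAut : ℂ ≃+* ℂ) • x → σ • t = t) → σ • ψ₀ ∉ (Φ i₁).1)) :
    ¬ CMAlgebra.IsNondegenerateFamily Φ := by
  haveI : Nonempty I := ⟨i₀⟩
  have h8 := finrank_eq_eight_of_reflexOctic h6 hflip Φ hψ₀
  intro hnd
  have hΨ := hnd.isNondegenerate i₁
  rw [isNondegenerate_iff, h8] at hΨ
  rw [CMAlgebra.isNondegenerateFamily_iff, ReflexSlot.sum_eq_add_of_two h01 hI, h6, h8,
    cmFamilyRank_eq_of_reflexOctic_ball hI h6 hflip Φ hψ₀ hball, hΨ] at hnd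
  norm_num at hnd

/-- **ADDITIVITY off the Hamming balls**: `rank(Φ_T, Ψ) = rank(Ψ) + 3` — `Hg(T × F) = Hg(T) × Hg(F)`.
[cite: Gordon1999HodgeAVSurvey, §3 Theorem (1), 7.5] [cite: Dodson1984, §5.1.2] -/
theorem cmFamilyRank_eq_add_three_of_reflexOctic {i₀ i₁ : I} (h01 : i₀ ≠ i₁) (hI : ∀ j, j = i₀ ∨ j = i₁)
    (h6 : finrank ℚ (K i₀) = 6)
    (hflip : ∀ s : K i₀ →+* ℂ, ∃ σ : ℂ ≃+* ℂ, σ • s = (starRingAut : ℂ ≃+* ℂ) • s ∧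
      ∀ t : K i₀ →+* ℂ, t ≠ s → t ≠ (starRingAut : ℂ ≃+* ℂ) • s → σ • t = t)
    (Φ : ∀ i, CMType (K i)) {ψ₀ : K i₁ →+* ℂ}
    (hψ₀ : ∀ σ : ℂ ≃+* ℂ, σ • ψ₀ = ψ₀ ↔ ∀ x : K i₀ →+* ℂ, σ • x ∈ (Φ i₀).1 ↔ x ∈ (Φ i₀).1)
    (hball : ¬ (ψ₀ ∈ (Φ i₁).1 ∧ ∀ (x : K i₀ →+* ℂ) (σ : ℂ ≃+* ℂ), x ∈ (Φ i₀).1 →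
        σ • x = (starRingAut : ℂ ≃+* ℂ) • x →
        (∀ t : K i₀ →+* ℂ, t ≠ x → t ≠ (starRingAut : ℂ ≃+* ℂ) • x → σ • t = t) → σ • ψ₀ ∈ (Φ i₁).1))
    (hball' : ¬ (ψ₀ ∉ (Φ i₁).1 ∧ ∀ (x : K i₀ →+* ℂ) (σ : ℂ ≃+* ℂ), x ∈ (Φ i₀).1 →
        σ • x = (starRingAut : ℂ ≃+* ℂ) • x →
        (∀ t : K i₀ →+* ℂ, t ≠ x → t ≠ (starRingAut : ℂ ≃+* ℂ) • x → σ • t = t) → σ • ψ₀ ∉ (Φ i₁).1)) :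
    CMAlgebra.cmFamilyRank Φ = cmTypeRank (Φ i₁) + 3 := by
  obtain ⟨T, x₁, x₂, x₃, φ₁, φ₂, φ₃, hT, hTi, hT₀, hY, hx, h12, h13, h23, hφ₁, hφ₂, hφ₃⟩ :=
    exists_reflexSlot_data h6 hflip Φ hψ₀
  have h := fun i => isCMTypeWith_conj (Φ i)
  haveI := isPretransitive_ringEquiv_complex (K := K i₀)
  -- off the balls the three face sums do not coincide non-trivially
  have hS := (not_congr (ReflexSlot.faceSums_eq_iff_ball (Φ := fun i => (Φ i).1) h hT hTi hT₀ hY hx h12 h13 h23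
    hφ₁ hφ₂ hφ₃)).2 (by
      rintro (⟨h0, p₁, p₂, p₃⟩ | ⟨h0, p₁, p₂, p₃⟩)
      · refine hball ⟨h0, fun x σ hxm hσ hσ' => ?_⟩
        have agree : ∀ {φ : ℂ ≃+* ℂ} {x' : K i₀ →+* ℂ}, (φ • x' = (starRingAut : ℂ ≃+* ℂ) • x' ∧
            ∀ z : K i₀ →+* ℂ, z ≠ x' → z ≠ (starRingAut : ℂ ≃+* ℂ) • x' → φ • z = z) → x = x' →
            σ • ψ₀ = φ • ψ₀ := fun {φ x'} hφ hxx' =>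
          ReflexSlot.smul_eq_smul_of_forall_smul_eq hT hTi
            (ReflexSlot.pairFlip_smul_eq_pairFlip_smul (h i₀) ⟨hσ, hσ'⟩ (hxx' ▸ hφ)) ψ₀
        rw [hx] at hxm
        rcases hxm with rfl | rfl | rfl
        · rw [agree hφ₁ rfl]; exact p₁
        · rw [agree hφ₂ rfl]; exact p₂
        · rw [agree hφ₃ rfl]; exact p₃
      · refine hball' ⟨h0, fun x σ hxm hσ hσ' => ?_⟩
        have agree : ∀ {φ : ℂ ≃+* ℂ} {x' : K i₀ →+* ℂ}, (φ • x' = (starRingAut : ℂ ≃+* ℂ) • x' ∧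
            ∀ z : K i₀ →+* ℂ, z ≠ x' → z ≠ (starRingAut : ℂ ≃+* ℂ) • x' → φ • z = z) → x = x' →
            σ • ψ₀ = φ • ψ₀ := fun {φ x'} hφ hxx' =>
          ReflexSlot.smul_eq_smul_of_forall_smul_eq hT hTi
            (ReflexSlot.pairFlip_smul_eq_pairFlip_smul (h i₀) ⟨hσ, hσ'⟩ (hxx' ▸ hφ)) ψ₀
        rw [hx] at hxm
        rcases hxm with rfl | rfl | rfl
        · rw [agree hφ₁ rfl]; exact p₁
        · rw [agree hφ₂ rfl]; exact p₂
        · rw [agree hφ₃ rfl]; exact p₃)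
  have hS' : (∑ y ∈ Finset.univ.filter (fun y => x₁ ∈ T y), antiVec (Φ i₁).1 (1 : ℂ ≃+* ℂ) y) =
        ∑ y ∈ Finset.univ.filter (fun y => x₂ ∈ T y), antiVec (Φ i₁).1 (1 : ℂ ≃+* ℂ) y →
      (∑ y ∈ Finset.univ.filter (fun y => x₂ ∈ T y), antiVec (Φ i₁).1 (1 : ℂ ≃+* ℂ) y) =
        ∑ y ∈ Finset.univ.filter (fun y => x₃ ∈ T y), antiVec (Φ i₁).1 (1 : ℂ ≃+* ℂ) y →
      (∑ y ∈ Finset.univ.filter (fun y => x₁ ∈ T y), antiVec (Φ i₁).1 (1 : ℂ ≃+* ℂ) y) = 0 := by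
    intro e12 e23
    by_contra hne
    exact hS ⟨e12, e23, hne⟩
  have hadd := ReflexSlot.typeRank_sigmaType_eq_add_of_faceSums (Φ := fun i => (Φ i).1) h h01 hI hT hTi hT₀ hY hx
    h12 h13 h23 hφ₁ hφ₂ hφ₃ hS'
  rw [Embeddings.card, h6] at hadd
  exact hadd

/-- **The dichotomy by the types.**  `(Φ_T, Ψ)` is a nondegenerate family iff `Ψ` is nondegenerate and `Ψ` is neither
the Hamming ball around `Φ_T` (`ψ₀` and its three flip-neighbours in `Ψ`) nor the one around `Φ̄_T` (none of them in
`Ψ`). [cite: Gordon1999HodgeAVSurvey, 7.5–7.7] [cite: Dodson1984, §3.3.2 and Prop. 5.2.2] [cite: Shimura1998, §8.3 Prop. 28] -/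
theorem isNondegenerateFamily_iff_of_reflexOctic {i₀ i₁ : I} (h01 : i₀ ≠ i₁) (hI : ∀ j, j = i₀ ∨ j = i₁)
    (h6 : finrank ℚ (K i₀) = 6)
    (hflip : ∀ s : K i₀ →+* ℂ, ∃ σ : ℂ ≃+* ℂ, σ • s = (starRingAut : ℂ ≃+* ℂ) • s ∧
      ∀ t : K i₀ →+* ℂ, t ≠ s → t ≠ (starRingAut : ℂ ≃+* ℂ) • s → σ • t = t)
    (Φ : ∀ i, CMType (K i)) {ψ₀ : K i₁ →+* ℂ}
    (hψ₀ : ∀ σ : ℂ ≃+* ℂ, σ • ψ₀ = ψ₀ ↔ ∀ x : K i₀ →+* ℂ, σ • x ∈ (Φ i₀).1 ↔ x ∈ (Φ i₀).1) :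
    CMAlgebra.IsNondegenerateFamily Φ ↔ IsNondegenerate (Φ i₁) ∧
      ¬ (ψ₀ ∈ (Φ i₁).1 ∧ ∀ (x : K i₀ →+* ℂ) (σ : ℂ ≃+* ℂ), x ∈ (Φ i₀).1 →
        σ • x = (starRingAut : ℂ ≃+* ℂ) • x →
        (∀ t : K i₀ →+* ℂ, t ≠ x → t ≠ (starRingAut : ℂ ≃+* ℂ) • x → σ • t = t) → σ • ψ₀ ∈ (Φ i₁).1) ∧
      ¬ (ψ₀ ∉ (Φ i₁).1 ∧ ∀ (x : K i₀ →+* ℂ) (σ : ℂ ≃+* ℂ), x ∈ (Φ i₀).1 →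
        σ • x = (starRingAut : ℂ ≃+* ℂ) • x →
        (∀ t : K i₀ →+* ℂ, t ≠ x → t ≠ (starRingAut : ℂ ≃+* ℂ) • x → σ • t = t) → σ • ψ₀ ∉ (Φ i₁).1) := by
  haveI : Nonempty I := ⟨i₀⟩
  have h8 := finrank_eq_eight_of_reflexOctic h6 hflip Φ hψ₀
  constructor
  · intro hnd
    refine ⟨hnd.isNondegenerate i₁, fun hb => ?_, fun hb => ?_⟩
    · exact not_isNondegenerateFamily_of_reflexOctic_ball h01 hI h6 hflip Φ hψ₀ (Or.inl hb) hnd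
    · exact not_isNondegenerateFamily_of_reflexOctic_ball h01 hI h6 hflip Φ hψ₀ (Or.inr hb) hnd
  · rintro ⟨hΨ, hb, hb'⟩
    rw [isNondegenerate_iff, h8] at hΨ
    rw [CMAlgebra.isNondegenerateFamily_iff, ReflexSlot.sum_eq_add_of_two h01 hI, h6, h8,
      cmFamilyRank_eq_add_three_of_reflexOctic h01 hI h6 hflip Φ hψ₀ hb hb', hΨ]
    norm_num

/-- **Closure form.**  The same dichotomy with the pair flips supplied by the degree `24`/`48` of the Galois closure
of the sextic field (`SexticCMFieldPairFlip.pairFlip_of_finrank_normalClosure`). [cite: Dodson1984, §5.1.2 and §3.3.2] -/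
theorem isNondegenerateFamily_iff_of_reflexOctic_of_finrank_normalClosure {i₀ i₁ : I} (h01 : i₀ ≠ i₁)
    (hI : ∀ j, j = i₀ ∨ j = i₁) (h6 : finrank ℚ (K i₀) = 6) (L : Type) [Field L] [NumberField L]
    [IsNormalClosure ℚ (K i₀) L] (hL : finrank ℚ L = 24 ∨ finrank ℚ L = 48)
    (Φ : ∀ i, CMType (K i)) {ψ₀ : K i₁ →+* ℂ}
    (hψ₀ : ∀ σ : ℂ ≃+* ℂ, σ • ψ₀ = ψ₀ ↔ ∀ x : K i₀ →+* ℂ, σ • x ∈ (Φ i₀).1 ↔ x ∈ (Φ i₀).1) :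
    CMAlgebra.IsNondegenerateFamily Φ ↔ IsNondegenerate (Φ i₁) ∧
      ¬ (ψ₀ ∈ (Φ i₁).1 ∧ ∀ (x : K i₀ →+* ℂ) (σ : ℂ ≃+* ℂ), x ∈ (Φ i₀).1 →
        σ • x = (starRingAut : ℂ ≃+* ℂ) • x →
        (∀ t : K i₀ →+* ℂ, t ≠ x → t ≠ (starRingAut : ℂ ≃+* ℂ) • x → σ • t = t) → σ • ψ₀ ∈ (Φ i₁).1) ∧
      ¬ (ψ₀ ∉ (Φ i₁).1 ∧ ∀ (x : K i₀ →+* ℂ) (σ : ℂ ≃+* ℂ), x ∈ (Φ i₀).1 →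
        σ • x = (starRingAut : ℂ ≃+* ℂ) • x →
        (∀ t : K i₀ →+* ℂ, t ≠ x → t ≠ (starRingAut : ℂ ≃+* ℂ) • x → σ • t = t) → σ • ψ₀ ∉ (Φ i₁).1) :=
  isNondegenerateFamily_iff_of_reflexOctic h01 hI h6 (GenericCMField.pairFlip_of_finrank_normalClosure h6 L hL) Φ hψ₀

end Types

/-! ### §3 Geometry: `T^a × F^b` -/

section Geometry

variable {I : Type} {K : I → Type} [∀ i, Field (K i)] [∀ i, NumberField (K i)] [∀ i, IsCMField (K i)] [Fintype I]
  [DecidableEq I] {Φ : ∀ i, CMType (K i)}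
variable {A : I → AbelianVariety ℂ} {ι : ∀ i, 𝓞 (K i) →+* End (A i)}
  {θ : ∀ i, K i →+* Module.End ℂ (complexBetti (A i).X 1)}

omit [DecidableEq I] in
/-- **Off the Hamming balls: the Hodge conjecture and `B• = D•` on EVERY `T^a × F^b`**, UNCONDITIONALLY — `T` a
realisation of a type of a pair-flip sextic field, `F` a realisation of a NONDEGENERATE type `Ψ` of the reflex field,
`Ψ` neither Hamming ball. [cite: Gordon1999HodgeAVSurvey, 7.5 and 10.10] [cite: Dodson1984, §3.3.2] -/
theorem hodgeConjectureFor_prod_of_reflexOctic {i₀ i₁ : I} (h01 : i₀ ≠ i₁) (hI : ∀ j, j = i₀ ∨ j = i₁)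
    (h6 : finrank ℚ (K i₀) = 6)
    (hflip : ∀ s : K i₀ →+* ℂ, ∃ σ : ℂ ≃+* ℂ, σ • s = (starRingAut : ℂ ≃+* ℂ) • s ∧
      ∀ t : K i₀ →+* ℂ, t ≠ s → t ≠ (starRingAut : ℂ ≃+* ℂ) • s → σ • t = t)
    {ψ₀ : K i₁ →+* ℂ}
    (hψ₀ : ∀ σ : ℂ ≃+* ℂ, σ • ψ₀ = ψ₀ ↔ ∀ x : K i₀ →+* ℂ, σ • x ∈ (Φ i₀).1 ↔ x ∈ (Φ i₀).1)
    (hΨ : IsNondegenerate (Φ i₁))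
    (hball : ¬ (ψ₀ ∈ (Φ i₁).1 ∧ ∀ (x : K i₀ →+* ℂ) (σ : ℂ ≃+* ℂ), x ∈ (Φ i₀).1 →
        σ • x = (starRingAut : ℂ ≃+* ℂ) • x →
        (∀ t : K i₀ →+* ℂ, t ≠ x → t ≠ (starRingAut : ℂ ≃+* ℂ) • x → σ • t = t) → σ • ψ₀ ∈ (Φ i₁).1))
    (hball' : ¬ (ψ₀ ∉ (Φ i₁).1 ∧ ∀ (x : K i₀ →+* ℂ) (σ : ℂ ≃+* ℂ), x ∈ (Φ i₀).1 →
        σ • x = (starRingAut : ℂ ≃+* ℂ) • x →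
        (∀ t : K i₀ →+* ℂ, t ≠ x → t ≠ (starRingAut : ℂ ≃+* ℂ) • x → σ • t = t) → σ • ψ₀ ∉ (Φ i₁).1))
    (hA : ∀ i, IsCMTypeRealisation (Φ i) (A i) (ι i) (θ i)) {N : ℕ} (π : Fin N → I) :
    HodgeConjectureFor (⨁ fun j : Fin N => A (π j)).dim (⨁ fun j : Fin N => A (π j)).X ∧
      ∀ m : ℕ, hodgeClassSpan (⨁ fun j : Fin N => A (π j)).dim (⨁ fun j : Fin N => A (π j)).X m =
        divisorClassesSpan (⨁ fun j : Fin N => A (π j)).X (⨁ fun j : Fin N => A (π j)).dim m := by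
  haveI : Nonempty I := ⟨i₀⟩
  have hnd := (isNondegenerateFamily_iff_of_reflexOctic h01 hI h6 hflip Φ hψ₀).2 ⟨hΨ, hball, hball'⟩
  exact ⟨hnd.hodgeConjectureFor_prod hA π, fun m => hnd.hodgeClassSpan_prod_eq_divisorClassesSpan hA π m⟩

/-- **On the Hamming balls: an exceptional Hodge class on some `T^a × F^b`** for SIMPLE realisations `T`, `F` — an
exotic pair in dimension `7` whose fields share no imaginary quadratic subfield and whose fourfold may be nondegenerate.
[cite: Gordon1999HodgeAVSurvey, 7.5] [cite: MoonenZarhin1999LowDim, Thm. (0.2) (a)] [cite: Dodson1984, Prop. 5.2.2] -/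
theorem exists_exceptional_prod_of_reflexOctic_ball {i₀ i₁ : I} (h01 : i₀ ≠ i₁) (hI : ∀ j, j = i₀ ∨ j = i₁)
    (h6 : finrank ℚ (K i₀) = 6)
    (hflip : ∀ s : K i₀ →+* ℂ, ∃ σ : ℂ ≃+* ℂ, σ • s = (starRingAut : ℂ ≃+* ℂ) • s ∧
      ∀ t : K i₀ →+* ℂ, t ≠ s → t ≠ (starRingAut : ℂ ≃+* ℂ) • s → σ • t = t)
    {ψ₀ : K i₁ →+* ℂ}
    (hψ₀ : ∀ σ : ℂ ≃+* ℂ, σ • ψ₀ = ψ₀ ↔ ∀ x : K i₀ →+* ℂ, σ • x ∈ (Φ i₀).1 ↔ x ∈ (Φ i₀).1)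
    (hball : (ψ₀ ∈ (Φ i₁).1 ∧ ∀ (x : K i₀ →+* ℂ) (σ : ℂ ≃+* ℂ), x ∈ (Φ i₀).1 →
        σ • x = (starRingAut : ℂ ≃+* ℂ) • x →
        (∀ t : K i₀ →+* ℂ, t ≠ x → t ≠ (starRingAut : ℂ ≃+* ℂ) • x → σ • t = t) → σ • ψ₀ ∈ (Φ i₁).1) ∨
      (ψ₀ ∉ (Φ i₁).1 ∧ ∀ (x : K i₀ →+* ℂ) (σ : ℂ ≃+* ℂ), x ∈ (Φ i₀).1 →
        σ • x = (starRingAut : ℂ ≃+* ℂ) • x →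
        (∀ t : K i₀ →+* ℂ, t ≠ x → t ≠ (starRingAut : ℂ ≃+* ℂ) • x → σ • t = t) → σ • ψ₀ ∉ (Φ i₁).1))
    (hA : ∀ i, IsCMTypeRealisation (Φ i) (A i) (ι i) (θ i)) (hs : ∀ i, (A i).IsSimple) :
    ∃ (N : ℕ) (π : Fin N → I) (m : ℕ) (c : complexBetti (⨁ fun j : Fin N => A (π j)).X (2 * m)),
      IsRationalClass c ∧
      IsOfHodgeType (⨁ fun j : Fin N => A (π j)).dim (⨁ fun j : Fin N => A (π j)).X (2 * m) m m c ∧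
      c ∉ divisorClassesSpan (⨁ fun j : Fin N => A (π j)).X (⨁ fun j : Fin N => A (π j)).dim m := by
  haveI : Nonempty I := ⟨i₀⟩
  have h8 := finrank_eq_eight_of_reflexOctic h6 hflip Φ hψ₀
  refine CMAlgebra.exists_exceptional_prod_of_not_isNondegenerateFamily
    (isSeparatingFamily_of_isSimple_of_finrank_injective hA hs fun i j hij => ?_)
    (not_isNondegenerateFamily_of_reflexOctic_ball h01 hI h6 hflip Φ hψ₀ hball) hA
  rcases hI i with rfl | rfl <;> rcases hI j with rfl | rfl
  · rfl
  · rw [h6, h8] at hij; omega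
  · rw [h6, h8] at hij; omega
  · rfl

end Geometry

end Summit.HodgeConjecture.CorCM

end
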